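import Mathlib.Analysis.SpecialFunctions.Pow.Real
import Mathlib.Analysis.SpecialFunctions.Log.Basic
import Mathlib.Analysis.SpecialFunctions.Sqrt
import HarnessLib

/-!
# Polynomial bookkeeping for the flux-regime cone kernel bound
(namespace `Literature.Geometry.Lorentzian.Kerr`; pure real arithmetic.)

The one-sided envelopes of the normalised pair of Carter's equation (`CarterFluxEnvelopes.lean`) and the
two-point kernel bound (`Literature.Analysis.ODE.kernel_le_of_envelopes_barrier`) produce an explicit
kernel constant

  `K = 3·P_H²/|σ| + 3·P_I²/|ω| + 3·√P_H²·√P_I²/(2√(ωσ)) + 2·(L + (7/5)R)`,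
  `P_H² = 2·3⁹ + T·3¹⁰σ²/η²`, `P_I² = P_f² + B/η² + (3⁹B/η² + 2·3⁸B/σ²)`,
  `T = (Φ/η²)¹⁶·E`, `B = T·(η²P_f² + 2ω²)`, `P_f = 2 + 2|ω|R`,

in terms of the atomic quantities `σ = ω − mω₊`, `ω`, `η`, `Φ` (coefficient bound), `R` (far radius),
`L` (near-zone tortoise length) and `E = exp(2ηL)`. When every atom is bounded by a power of ONE master
variable `Y ≥ 1` (`CarterConeArithmetic.coneMaster_bounds`), `K ≤ c_K·Y^176` for an absolute constant
`c_K`; this file proves exactly that implication (`kernelConstant_le_pow`) and the three derived atomic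
bounds it needs (`farRadius_le_pow`, `logArg_le_pow`, `exp_le_logArg_pow`). No analysis enters.

## References
* M. Dafermos, I. Rodnianski, Y. Shlapentokh-Rothman, arXiv:1402.7034, §8 ("all constants can be
  tracked"); here they are, polynomially in `Λ/κ`. Key `DafermosRodnianskiShlapentokhrothman2014`.
-/

noncomputable section

namespace Literature.Geometry.Lorentzian

namespace Kerr

/-! ### Small monomial toolkit (`Y ≥ 1`) -/

/-- `c·Y^i ≤ c·Y^j` for `i ≤ j`, `0 ≤ c`, `1 ≤ Y`. [folklore] -/
theorem mul_pow_le_mul_pow_of_le {Y c : ℝ} (hY : 1 ≤ Y) (hc : 0 ≤ c) {i j : ℕ} (hij : i ≤ j) :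
    c * Y ^ i ≤ c * Y ^ j :=
  mul_le_mul_of_nonneg_left (pow_le_pow_right₀ hY hij) hc

/-- Product of two monomial bounds. [folklore] -/
theorem mul_le_of_le_pow {Y a b c₁ c₂ : ℝ} {i j : ℕ} (ha0 : 0 ≤ a) (hb0 : 0 ≤ b) (ha : a ≤ c₁ * Y ^ i)
    (hb : b ≤ c₂ * Y ^ j) : a * b ≤ (c₁ * c₂) * Y ^ (i + j) := by
  calc a * b ≤ (c₁ * Y ^ i) * (c₂ * Y ^ j) := mul_le_mul ha hb hb0 (ha0.trans ha)
    _ = (c₁ * c₂) * Y ^ (i + j) := by rw [pow_add]; ring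

/-- Sum of two monomial bounds, raised to a common exponent. [folklore] -/
theorem add_le_of_le_pow {Y a b c₁ c₂ : ℝ} {i j k : ℕ} (hY : 1 ≤ Y) (hc₁ : 0 ≤ c₁) (hc₂ : 0 ≤ c₂)
    (ha : a ≤ c₁ * Y ^ i) (hb : b ≤ c₂ * Y ^ j) (hi : i ≤ k) (hj : j ≤ k) :
    a + b ≤ (c₁ + c₂) * Y ^ k := by
  have h1 := ha.trans (mul_pow_le_mul_pow_of_le hY hc₁ hi)
  have h2 := hb.trans (mul_pow_le_mul_pow_of_le hY hc₂ hj)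
  linarith

/-! ### Derived atomic bounds -/

/-- **Far radius**: `max(7M, √(12Λ)/|ω|, 1/(Mω²)) ≤ 12·Y³` when `1 ≤ Λ ≤ Y`, `M, M⁻¹ ≤ Y`, `|ω|⁻¹ ≤ Y`,
`1 ≤ Y`. [folklore] -/
theorem farRadius_le_pow {Y Λ M ω : ℝ} (hY : 1 ≤ Y) (hΛ1 : 1 ≤ Λ) (hΛ : Λ ≤ Y) (hM : M ≤ Y)
    (hMi : M⁻¹ ≤ Y) (hω : 0 < |ω|) (hωi : |ω|⁻¹ ≤ Y) :
    max (7 * M) (max (Real.sqrt (12 * Λ) / |ω|) (1 / (M * ω ^ 2))) ≤ 12 * Y ^ 3 := by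
  have hY0 : 0 < Y := by linarith
  have hY3 : Y ≤ Y ^ 3 := le_self_pow₀ hY (by norm_num)
  have hY23 : Y ^ 2 ≤ Y ^ 3 := pow_le_pow_right₀ hY (by norm_num)
  refine max_le ?_ (max_le ?_ ?_)
  · have : 0 ≤ Y ^ 3 := by positivity
    linarith
  · have hs : Real.sqrt (12 * Λ) ≤ 4 * Λ := by
      rw [Real.sqrt_le_left (by positivity)]
      nlinarith
    calc Real.sqrt (12 * Λ) / |ω| = Real.sqrt (12 * Λ) * |ω|⁻¹ := div_eq_mul_inv _ _
      _ ≤ (4 * Λ) * Y := mul_le_mul hs hωi (by positivity) (by positivity)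
      _ ≤ (4 * Y) * Y := by gcongr
      _ = 4 * Y ^ 2 := by ring
      _ ≤ 4 * Y ^ 3 := by gcongr
      _ ≤ 12 * Y ^ 3 := by linarith [pow_pos hY0 3]
  · rcases le_or_gt M 0 with hM0 | hM0
    · -- junk branch: `M ≤ 0` makes the term non-positive
      have : 1 / (M * ω ^ 2) ≤ 0 := by
        apply div_nonpos_of_nonneg_of_nonpos zero_le_one
        exact mul_nonpos_of_nonpos_of_nonneg hM0 (sq_nonneg ω)
      linarith [pow_pos hY0 3]
    · have e : 1 / (M * ω ^ 2) = M⁻¹ * (|ω|⁻¹) ^ 2 := by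
        rw [inv_pow, sq_abs, one_div, mul_inv]
      rw [e]
      calc M⁻¹ * |ω|⁻¹ ^ 2 ≤ Y * Y ^ 2 :=
            mul_le_mul hMi (pow_le_pow_left₀ (by positivity) hωi 2) (by positivity) (by positivity)
        _ = Y ^ 3 := by ring
        _ ≤ 12 * Y ^ 3 := by linarith [pow_pos hY0 3]

/-- **Argument of the logarithm**: `2496Λ/(σ²M²) ≤ 2496·Y⁴` when `Λ ≤ Y`, `|σ|⁻¹ ≤ Y`, `(M²)⁻¹ ≤ Y`,
`1 ≤ Y`. [folklore] -/
theorem logArg_le_pow {Y Λ M σ : ℝ} (hY : 1 ≤ Y) (hΛ : Λ ≤ Y) (hσ : σ ≠ 0)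
    (hσi : |σ|⁻¹ ≤ Y) (hM : 0 < M) (hM2i : (M ^ 2)⁻¹ ≤ Y) :
    2496 * Λ / (σ ^ 2 * M ^ 2) ≤ 2496 * Y ^ 4 := by
  have hσ2 : (σ ^ 2)⁻¹ ≤ Y ^ 2 := by
    rw [← sq_abs, ← inv_pow]; exact pow_le_pow_left₀ (by positivity) hσi 2
  have e : 2496 * Λ / (σ ^ 2 * M ^ 2) = 2496 * (Λ * ((σ ^ 2)⁻¹ * (M ^ 2)⁻¹)) := by
    rw [div_eq_mul_inv, mul_inv]; ring
  rw [e]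
  have : Λ * ((σ ^ 2)⁻¹ * (M ^ 2)⁻¹) ≤ Y * (Y ^ 2 * Y) := by
    apply mul_le_mul hΛ _ (by positivity) (by linarith)
    exact mul_le_mul hσ2 hM2i (by positivity) (by positivity)
  have e : (2496 : ℝ) * Y ^ 4 = 2496 * (Y * (Y ^ 2 * Y)) := by ring
  rw [e]; linarith

/-- **The exponential factor**: if `η ≤ κ/2`, `0 < κ` and `1 ≤ Q`, then
`exp(2η·(25/κ)·log Q) ≤ Q^25`. [folklore] -/
theorem exp_le_logArg_pow {η κ Q : ℝ} (hκ : 0 < κ) (hη : η ≤ κ / 2) (hQ : 1 ≤ Q) :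
    Real.exp (2 * η * (25 / κ * Real.log Q)) ≤ Q ^ 25 := by
  have hlog : 0 ≤ Real.log Q := Real.log_nonneg hQ
  have hcoef : 2 * η * (25 / κ) ≤ 25 := by
    have e : 2 * η * (25 / κ) = 25 * (2 * η / κ) := by ring
    rw [e]
    have h1 : 2 * η / κ ≤ 1 := by rw [div_le_one hκ]; linarith
    nlinarith
  have h1 : 2 * η * (25 / κ * Real.log Q) ≤ 25 * Real.log Q := by
    rw [show 2 * η * (25 / κ * Real.log Q) = (2 * η * (25 / κ)) * Real.log Q by ring]
    exact mul_le_mul_of_nonneg_right hcoef hlog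
  calc Real.exp (2 * η * (25 / κ * Real.log Q)) ≤ Real.exp (25 * Real.log Q) := Real.exp_le_exp.2 h1
    _ = Real.exp (Real.log Q) ^ 25 := by rw [← Real.exp_nat_mul]; norm_num
    _ = Q ^ 25 := by rw [Real.exp_log (by linarith)]

/-! ### The kernel constant -/

/-- **Polynomial bound of the flux-regime kernel constant.** There are absolute constants `c_K > 0` and
`N` (here `N = 176`) such that for all reals with `1 ≤ Y`, `0 < η`, `0 < ωσ`, `|σ|⁻¹ ≤ Y`,
`σ² ≤ Y²`, `|ω| ≤ Y`, `|ω|⁻¹ ≤ Y`, `η⁻¹ ≤ Y`, `η² ≤ Y`, `0 ≤ Φ ≤ 7Y²`, `0 ≤ R ≤ 12Y³`, `0 ≤ L ≤ 62400Y⁵`,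
`0 ≤ E ≤ 2496²⁵Y¹⁰⁰`, the kernel constant `K` of the module docstring satisfies `K ≤ c_K·Y^N`.
[folklore] -/
theorem kernelConstant_le_pow : ∃ (cK : ℝ) (N : ℕ), 0 < cK ∧
    ∀ (Y σ ω η Φ R L E : ℝ), 1 ≤ Y → 0 < η → 0 < ω * σ →
      |σ|⁻¹ ≤ Y → σ ^ 2 ≤ Y ^ 2 → |ω| ≤ Y → |ω|⁻¹ ≤ Y → η⁻¹ ≤ Y → η ^ 2 ≤ Y →
      0 ≤ Φ → Φ ≤ 7 * Y ^ 2 → 0 ≤ R → R ≤ 12 * Y ^ 3 → 0 ≤ L → L ≤ 62400 * Y ^ 5 →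
      0 ≤ E → E ≤ 2496 ^ 25 * Y ^ 100 →
      3 * (2 * 3 ^ 9 + (Φ / η ^ 2) ^ 16 * E * (3 ^ 10 * σ ^ 2) / η ^ 2) / |σ| +
      3 * ((2 + 2 * |ω| * R) ^ 2 +
            (Φ / η ^ 2) ^ 16 * E * (η ^ 2 * (2 + 2 * |ω| * R) ^ 2 + 2 * ω ^ 2) / η ^ 2 +
            (3 ^ 9 * ((Φ / η ^ 2) ^ 16 * E * (η ^ 2 * (2 + 2 * |ω| * R) ^ 2 + 2 * ω ^ 2)) / η ^ 2 +
              2 * 3 ^ 8 * ((Φ / η ^ 2) ^ 16 * E * (η ^ 2 * (2 + 2 * |ω| * R) ^ 2 + 2 * ω ^ 2)) /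
                σ ^ 2)) / |ω| +
      3 * (Real.sqrt (2 * 3 ^ 9 + (Φ / η ^ 2) ^ 16 * E * (3 ^ 10 * σ ^ 2) / η ^ 2) *
            Real.sqrt ((2 + 2 * |ω| * R) ^ 2 +
              (Φ / η ^ 2) ^ 16 * E * (η ^ 2 * (2 + 2 * |ω| * R) ^ 2 + 2 * ω ^ 2) / η ^ 2 +
              (3 ^ 9 * ((Φ / η ^ 2) ^ 16 * E * (η ^ 2 * (2 + 2 * |ω| * R) ^ 2 + 2 * ω ^ 2)) / η ^ 2 +
                2 * 3 ^ 8 * ((Φ / η ^ 2) ^ 16 * E * (η ^ 2 * (2 + 2 * |ω| * R) ^ 2 + 2 * ω ^ 2)) /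
                  σ ^ 2))) / (2 * Real.sqrt (ω * σ)) +
      2 * (L + 7 / 5 * R) ≤ cK * Y ^ N := by
  -- absolute constants
  set cT : ℝ := 7 ^ 16 * 2496 ^ 25 with hcT
  set cH : ℝ := 2 * 3 ^ 9 + cT * 3 ^ 10 with hcH
  set cB : ℝ := cT * 678 with hcB
  set cI : ℝ := 676 + 32806 * cB with hcI
  refine ⟨4 * cH + 4 * cI + 124834, 176, by positivity, ?_⟩
  intro Y σ ω η Φ R L E hY hη hωσ hσi hσ2 hω hωi hηi hη2 hΦ0 hΦ hR0 hR hL0 hL hE0 hE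
  have hY0 : 0 < Y := by linarith
  have hσ0 : σ ≠ 0 := fun e ↦ by simp [e] at hωσ
  have hω0 : ω ≠ 0 := fun e ↦ by simp [e] at hωσ
  have hσa : 0 < |σ| := abs_pos.2 hσ0
  have hωa : 0 < |ω| := abs_pos.2 hω0
  have hη20 : 0 < η ^ 2 := by positivity
  have hηi2 : (η ^ 2)⁻¹ ≤ Y ^ 2 := by rw [← inv_pow]; exact pow_le_pow_left₀ (by positivity) hηi 2
  have hσi2 : (σ ^ 2)⁻¹ ≤ Y ^ 2 := by
    rw [← sq_abs, ← inv_pow]; exact pow_le_pow_left₀ (by positivity) hσi 2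
  have hω2 : ω ^ 2 ≤ Y ^ 2 := by rw [← sq_abs]; exact pow_le_pow_left₀ (abs_nonneg _) hω 2
  -- T := (Φ/η²)^16 E ≤ cT Y^164
  have hΦη : Φ / η ^ 2 ≤ 7 * Y ^ 4 := by
    rw [div_eq_mul_inv]
    calc Φ * (η ^ 2)⁻¹ ≤ (7 * Y ^ 2) * Y ^ 2 := mul_le_mul hΦ hηi2 (by positivity) (by positivity)
      _ = 7 * Y ^ 4 := by ring
  have hΦη0 : 0 ≤ Φ / η ^ 2 := by positivity
  have hT : (Φ / η ^ 2) ^ 16 * E ≤ cT * Y ^ 164 := by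
    have h1 : (Φ / η ^ 2) ^ 16 ≤ (7 * Y ^ 4) ^ 16 := pow_le_pow_left₀ hΦη0 hΦη 16
    calc (Φ / η ^ 2) ^ 16 * E ≤ (7 * Y ^ 4) ^ 16 * (2496 ^ 25 * Y ^ 100) :=
          mul_le_mul h1 hE hE0 (by positivity)
      _ = cT * Y ^ 164 := by rw [hcT]; ring
  have hT0 : 0 ≤ (Φ / η ^ 2) ^ 16 * E := by positivity
  set T := (Φ / η ^ 2) ^ 16 * E with hTdef
  -- P_H² ≤ cH Y^168
  have hPH : 2 * 3 ^ 9 + T * (3 ^ 10 * σ ^ 2) / η ^ 2 ≤ cH * Y ^ 168 := by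
    have h1 : T * (3 ^ 10 * σ ^ 2) / η ^ 2 ≤ cT * 3 ^ 10 * Y ^ 168 := by
      rw [div_eq_mul_inv]
      calc T * (3 ^ 10 * σ ^ 2) * (η ^ 2)⁻¹ ≤ (cT * Y ^ 164) * (3 ^ 10 * Y ^ 2) * Y ^ 2 := by
            apply mul_le_mul _ hηi2 (by positivity) (by positivity)
            exact mul_le_mul hT (by linarith) (by positivity) (by positivity)
        _ = cT * 3 ^ 10 * Y ^ 168 := by ring
    have h2 : (2 * 3 ^ 9 : ℝ) ≤ 2 * 3 ^ 9 * Y ^ 168 :=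
      le_mul_of_one_le_right (by positivity) (one_le_pow₀ hY)
    calc _ ≤ 2 * 3 ^ 9 * Y ^ 168 + cT * 3 ^ 10 * Y ^ 168 := add_le_add h2 h1
      _ = cH * Y ^ 168 := by rw [hcH]; ring
  have hPH0 : 0 ≤ 2 * 3 ^ 9 + T * (3 ^ 10 * σ ^ 2) / η ^ 2 := by positivity
  -- P_f := 2 + 2|ω|R ≤ 26 Y^4 ; P_f² ≤ 676 Y^8
  have hPf : 2 + 2 * |ω| * R ≤ 26 * Y ^ 4 := by
    have h1 : |ω| * R ≤ Y * (12 * Y ^ 3) := mul_le_mul hω hR hR0 (by positivity)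
    have h4 : (1 : ℝ) ≤ Y ^ 4 := one_le_pow₀ hY
    have e : Y * (12 * Y ^ 3) = 12 * Y ^ 4 := by ring
    rw [e] at h1
    have : 2 * |ω| * R = 2 * (|ω| * R) := by ring
    rw [this]; linarith
  have hPf0 : 0 ≤ 2 + 2 * |ω| * R := by positivity
  have hPf2 : (2 + 2 * |ω| * R) ^ 2 ≤ 676 * Y ^ 8 := by
    calc (2 + 2 * |ω| * R) ^ 2 ≤ (26 * Y ^ 4) ^ 2 := pow_le_pow_left₀ hPf0 hPf 2
      _ = 676 * Y ^ 8 := by ring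
  -- B := T (η² P_f² + 2 ω²) ≤ cB Y^173
  have hBr : η ^ 2 * (2 + 2 * |ω| * R) ^ 2 + 2 * ω ^ 2 ≤ 678 * Y ^ 9 := by
    have h1 : η ^ 2 * (2 + 2 * |ω| * R) ^ 2 ≤ Y * (676 * Y ^ 8) :=
      mul_le_mul hη2 hPf2 (by positivity) (by positivity)
    have h2 : 2 * ω ^ 2 ≤ 2 * Y ^ 9 := by
      have := pow_le_pow_right₀ hY (show 2 ≤ 9 by norm_num); linarith
    have e : (678 : ℝ) * Y ^ 9 = Y * (676 * Y ^ 8) + 2 * Y ^ 9 := by ring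
    rw [e]; exact add_le_add h1 h2
  have hB : T * (η ^ 2 * (2 + 2 * |ω| * R) ^ 2 + 2 * ω ^ 2) ≤ cB * Y ^ 173 := by
    calc _ ≤ (cT * Y ^ 164) * (678 * Y ^ 9) := mul_le_mul hT hBr (by positivity) (by positivity)
      _ = cB * Y ^ 173 := by rw [hcB]; ring
  have hB0 : 0 ≤ T * (η ^ 2 * (2 + 2 * |ω| * R) ^ 2 + 2 * ω ^ 2) := by positivity
  set B := T * (η ^ 2 * (2 + 2 * |ω| * R) ^ 2 + 2 * ω ^ 2) with hBdef
  -- P_I² ≤ cI Y^175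
  have hBη : B / η ^ 2 ≤ cB * Y ^ 175 := by
    rw [div_eq_mul_inv]
    calc B * (η ^ 2)⁻¹ ≤ (cB * Y ^ 173) * Y ^ 2 := mul_le_mul hB hηi2 (by positivity) (by positivity)
      _ = cB * Y ^ 175 := by ring
  have hBσ : B / σ ^ 2 ≤ cB * Y ^ 175 := by
    rw [div_eq_mul_inv]
    calc B * (σ ^ 2)⁻¹ ≤ (cB * Y ^ 173) * Y ^ 2 := mul_le_mul hB hσi2 (by positivity) (by positivity)
      _ = cB * Y ^ 175 := by ring
  have hPI : (2 + 2 * |ω| * R) ^ 2 + B / η ^ 2 + (3 ^ 9 * B / η ^ 2 + 2 * 3 ^ 8 * B / σ ^ 2) ≤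
      cI * Y ^ 175 := by
    have h1 : (2 + 2 * |ω| * R) ^ 2 ≤ 676 * Y ^ 175 :=
      hPf2.trans (mul_pow_le_mul_pow_of_le hY (by norm_num) (by norm_num))
    have h2 : 3 ^ 9 * B / η ^ 2 = 3 ^ 9 * (B / η ^ 2) := by ring
    have h3 : 2 * 3 ^ 8 * B / σ ^ 2 = 2 * 3 ^ 8 * (B / σ ^ 2) := by ring
    rw [h2, h3]
    have e : cI * Y ^ 175 = 676 * Y ^ 175 + cB * Y ^ 175 + (3 ^ 9 * (cB * Y ^ 175) +
        2 * 3 ^ 8 * (cB * Y ^ 175)) := by rw [hcI]; ring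
    rw [e]
    gcongr
  have hPI0 : 0 ≤ (2 + 2 * |ω| * R) ^ 2 + B / η ^ 2 + (3 ^ 9 * B / η ^ 2 + 2 * 3 ^ 8 * B / σ ^ 2) := by
    positivity
  set PH := 2 * 3 ^ 9 + T * (3 ^ 10 * σ ^ 2) / η ^ 2 with hPHdef
  set PI := (2 + 2 * |ω| * R) ^ 2 + B / η ^ 2 + (3 ^ 9 * B / η ^ 2 + 2 * 3 ^ 8 * B / σ ^ 2) with hPIdef
  -- the four summands
  have hcH0 : 0 ≤ cH := by positivity
  have hcI0 : 0 ≤ cI := by positivity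
  have h176 : (1 : ℝ) ≤ Y ^ 176 := one_le_pow₀ hY
  have t1 : 3 * PH / |σ| ≤ 3 * cH * Y ^ 176 := by
    rw [div_eq_mul_inv]
    calc 3 * PH * |σ|⁻¹ ≤ 3 * (cH * Y ^ 168) * Y := by
          apply mul_le_mul _ hσi (by positivity) (by positivity)
          linarith
      _ = 3 * cH * Y ^ 169 := by ring
      _ ≤ 3 * cH * Y ^ 176 := mul_pow_le_mul_pow_of_le hY (by positivity) (by norm_num)
  have t2 : 3 * PI / |ω| ≤ 3 * cI * Y ^ 176 := by
    rw [div_eq_mul_inv]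
    calc 3 * PI * |ω|⁻¹ ≤ 3 * (cI * Y ^ 175) * Y := by
          apply mul_le_mul _ hωi (by positivity) (by positivity)
          linarith
      _ = 3 * cI * Y ^ 176 := by ring
  have t3 : 3 * (Real.sqrt PH * Real.sqrt PI) / (2 * Real.sqrt (ω * σ)) ≤ (cH + cI) * Y ^ 176 := by
    -- `√PH √PI ≤ (PH + PI)/2` and `1/(2√(ωσ)) ≤ Y/2`
    have hamgm : Real.sqrt PH * Real.sqrt PI ≤ (PH + PI) / 2 := by
      have h0 := sq_nonneg (Real.sqrt PH - Real.sqrt PI)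
      have e1 := Real.sq_sqrt hPH0
      have e2 := Real.sq_sqrt hPI0
      have : (Real.sqrt PH - Real.sqrt PI) ^ 2 =
          Real.sqrt PH ^ 2 + Real.sqrt PI ^ 2 - 2 * (Real.sqrt PH * Real.sqrt PI) := by ring
      rw [this, e1, e2] at h0
      linarith
    have hωσ' : ω * σ = |ω| * |σ| := by
      rw [← abs_mul]; exact (abs_of_pos hωσ).symm
    have hsq : Y⁻¹ ≤ Real.sqrt (ω * σ) := by
      rw [hωσ', Real.le_sqrt (by positivity) (by positivity)]
      have h1 : |ω|⁻¹ * |σ|⁻¹ ≤ Y * Y := mul_le_mul hωi hσi (by positivity) (by positivity)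
      rw [← mul_inv] at h1
      have h2 : (Y * Y)⁻¹ ≤ |ω| * |σ| := by
        rw [inv_le_comm₀ (by positivity) (by positivity)]; exact h1
      calc Y⁻¹ ^ 2 = (Y * Y)⁻¹ := by rw [sq, mul_inv]
        _ ≤ |ω| * |σ| := h2
    have hs0 : 0 < Real.sqrt (ω * σ) := Real.sqrt_pos.2 hωσ
    have hinv : 1 / (2 * Real.sqrt (ω * σ)) ≤ Y / 2 := by
      rw [div_le_div_iff₀ (by positivity) (by norm_num)]
      have : 1 ≤ Y * Real.sqrt (ω * σ) := by
        calc (1 : ℝ) = Y * Y⁻¹ := (mul_inv_cancel₀ hY0.ne').symm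
          _ ≤ Y * Real.sqrt (ω * σ) := by gcongr
      linarith
    calc 3 * (Real.sqrt PH * Real.sqrt PI) / (2 * Real.sqrt (ω * σ))
        = 3 * (Real.sqrt PH * Real.sqrt PI) * (1 / (2 * Real.sqrt (ω * σ))) := by ring
      _ ≤ 3 * ((PH + PI) / 2) * (Y / 2) := by
          refine mul_le_mul ?_ hinv (by positivity) (by positivity)
          linarith [hamgm]
      _ ≤ 3 * ((cH * Y ^ 168 + cI * Y ^ 175) / 2) * (Y / 2) := by gcongr
      _ ≤ 3 * ((cH * Y ^ 175 + cI * Y ^ 175) / 2) * (Y / 2) := by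
          have h1 : cH * Y ^ 168 ≤ cH * Y ^ 175 := mul_pow_le_mul_pow_of_le hY hcH0 (by norm_num)
          have h4 : 0 ≤ Y / 2 := by positivity
          calc 3 * ((cH * Y ^ 168 + cI * Y ^ 175) / 2) * (Y / 2)
              = (Y / 2) * (3 * ((cH * Y ^ 168 + cI * Y ^ 175) / 2)) := by ring
            _ ≤ (Y / 2) * (3 * ((cH * Y ^ 175 + cI * Y ^ 175) / 2)) :=
                mul_le_mul_of_nonneg_left (by linarith) h4
            _ = 3 * ((cH * Y ^ 175 + cI * Y ^ 175) / 2) * (Y / 2) := by ring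
      _ = 3 / 4 * ((cH + cI) * Y ^ 176) := by ring
      _ ≤ 1 * ((cH + cI) * Y ^ 176) :=
          mul_le_mul_of_nonneg_right (by norm_num) (mul_nonneg (add_nonneg hcH0 hcI0) (by positivity))
      _ = (cH + cI) * Y ^ 176 := one_mul _
  have t4 : 2 * (L + 7 / 5 * R) ≤ 124834 * Y ^ 176 := by
    have h1 : L ≤ 62400 * Y ^ 176 :=
      hL.trans (mul_pow_le_mul_pow_of_le hY (by norm_num) (by norm_num))
    have h2 : R ≤ 12 * Y ^ 176 :=
      hR.trans (mul_pow_le_mul_pow_of_le hY (by norm_num) (by norm_num))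
    linarith
  have e : (4 * cH + 4 * cI + 124834) * Y ^ 176 =
      3 * cH * Y ^ 176 + 3 * cI * Y ^ 176 + (cH + cI) * Y ^ 176 + 124834 * Y ^ 176 := by ring
  rw [e]
  linarith [t1, t2, t3, t4]

end Kerr

end Literature.Geometry.Lorentzian

end
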